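import Mathlib
import Summits.Parity.GeneralizedHardyLittlewood.Theorems.PrimeGapTorusCapPart5
import HarnessLib

/-!
# Prime-gap limit points, the torus cap (cell parity-ideate, p4 ROUND-12) — part 6/8 (`altSum_eq_coeff` … `torusCap_of_torusCapBrauer`)

Source: `HOME/parity-ideate-p4/round12/Sketch16.lean` (sha16 e5770481db81479a, 7 278 lines, farm rc 0 / 0 sorry /
axioms std-3; namespace `ParityIdeateP4R8`), cut by parity-ideate-lit g32 (`ports/toruscap/build_toruscap.py`) to the
dependency cone (143 declarations) of the eight headline declarations `torusCap_iff`, `torusCapBrauer_iff`,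
`torusCap_half`, `cb1_holds`, `conjHalfStrict_holds`, `NearAP.delannoyNonVanishing_holds`, `capGivesCoverage`,
`residueCoverage_half_of_literature`, in a chain of 8 files of ≤ 400 lines (Theorems-side lint); statements byte-identical
to the source except: `NearAP.P0/P1/P2` are `abbrev` (source: `def` + three `Decidable` instances, dropped per the typing
lint), examples and `decide` rungs outside the cone dropped, namespace `ParityIdeateP4R8` ↦ `Summit.Parity.GeneralizedHardyLittlewood.Theorems.PrimeGapTorusCap`.
Non-Mathlib inputs: `Literature.Combinatorics.Additive.ErdosHeilbronn` (combinatorial Nullstellensatz),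
`Literature.NumberTheory.Sieve.PrimeGapLimitPoints` (`primeGapLimitSet`, `HasPointProperty`, the NAMED fact
`Merikoski2020_theorem1`, used hypothesis-style, never asserted).  No `sorry`, no new axioms, no `instance`, no notation.
Cell-original mathematics (FRONTIER formalisation; nothing here bears on the parity problem beyond the typed statements):
CONJECTURE C of the cell = every measurable `perℤ`-periodic four-point-free `U ⊆ ℝ` has `μ(U ∩ [0,per)) ≤ per/2`,
sharp (mid arc); pay-off: residues of the prime-gap limit-point set `𝓛` modulo `λ` cover ≥ half of `[0, λ)` for every
`λ > 0`, given Merikoski's four-point theorem. HEADLINE DECLS IN THIS PART: `delannoyNonVanishing_holds`, `conjHalfStrict_holds`, `cb1_holds`.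
-/

namespace Summit.Parity.GeneralizedHardyLittlewood.Theorems.PrimeGapTorusCap.NearAP
open Finset Polynomial
section delannoyQ

/-- The alternating sum is a coefficient: `Σ_{t≤n} (-1)^t C(n,t) C(n+2,t) = [X^{n+2}] (1+X)^n (X-1)^{n+2}`. -/
theorem altSum_eq_coeff (R : Type*) [CommRing R] (n : ℕ) :
    ∑ t ∈ Finset.range (n + 1), (-1 : R) ^ t * ((n.choose t : ℕ) : R) * (((n + 2).choose t : ℕ) : R)
      = (((1 : R[X]) + X) ^ n * (X - 1) ^ (n + 2)).coeff (n + 2) := by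
  have hX : (X - 1 : R[X]) = X + C (-1) := by rw [map_neg, C_1, sub_eq_add_neg]
  rw [hX, coeff_mul, Finset.Nat.sum_antidiagonal_eq_sum_range_succ_mk]
  conv_rhs => rw [show (n + 2).succ = n + 1 + 1 + 1 from rfl, Finset.sum_range_succ, Finset.sum_range_succ]
  simp only [coeff_one_add_X_pow, coeff_X_add_C_pow]
  have hz1 : ((n.choose (n + 1) : ℕ) : R) = 0 := by
    rw [Nat.choose_eq_zero_of_lt (by omega), Nat.cast_zero]
  have hz2 : ((n.choose (n + 1 + 1) : ℕ) : R) = 0 := by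
    rw [Nat.choose_eq_zero_of_lt (by omega), Nat.cast_zero]
  rw [hz1, hz2, zero_mul, zero_mul, add_zero, add_zero]
  refine Finset.sum_congr rfl fun k hk => ?_
  have hk' : k ≤ n := by
    have := Finset.mem_range.1 hk
    omega
  rw [show n + 2 - (n + 2 - k) = k by omega, Nat.choose_symm (by omega : k ≤ n + 2)]
  ring

/-- `[X^j] (X²-1)^n`. -/
theorem coeff_X_sq_sub_one_pow (R : Type*) [CommRing R] (n j : ℕ) :
    ((X ^ 2 - 1 : R[X]) ^ n).coeff j
      = if 2 ∣ j then (-1 : R) ^ (n - j / 2) * ((n.choose (j / 2) : ℕ) : R) else 0 := by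
  have h : (X ^ 2 - 1 : R[X]) ^ n = expand R 2 ((X + C (-1)) ^ n) := by
    rw [map_pow, map_add, expand_X, expand_C, map_neg, C_1, ← sub_eq_add_neg]
  rw [h, coeff_expand (by norm_num), coeff_X_add_C_pow]

/-- (cell parity-ideate p4, Sketch16 — helper; statement verbatim) -/
theorem coeff_X_sq_sub_one_pow_even (R : Type*) [CommRing R] (n j : ℕ) :
    ((X ^ 2 - 1 : R[X]) ^ n).coeff (2 * j) = (-1 : R) ^ (n - j) * ((n.choose j : ℕ) : R) := by
  rw [coeff_X_sq_sub_one_pow, if_pos (dvd_mul_right 2 j), Nat.mul_div_cancel_left j (by norm_num)]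

/-- (cell parity-ideate p4, Sketch16 — helper; statement verbatim) -/
theorem coeff_X_sq_sub_one_pow_odd (R : Type*) [CommRing R] (n j : ℕ) :
    ((X ^ 2 - 1 : R[X]) ^ n).coeff (2 * j + 1) = 0 := by
  rw [coeff_X_sq_sub_one_pow, if_neg (by omega)]

/-- `[X^{n+2}] (1+X)^n (X-1)^{n+2} = e_n - 2e_{n+1} + e_{n+2}`, `e_j = [X^j](X²-1)^n`. -/
theorem coeff_closed_form (R : Type*) [CommRing R] (n : ℕ) :
    (((1 : R[X]) + X) ^ n * (X - 1) ^ (n + 2)).coeff (n + 2)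
      = ((X ^ 2 - 1 : R[X]) ^ n).coeff n - 2 * ((X ^ 2 - 1 : R[X]) ^ n).coeff (n + 1)
        + ((X ^ 2 - 1 : R[X]) ^ n).coeff (n + 2) := by
  have hpoly : ((1 : R[X]) + X) ^ n * (X - 1) ^ (n + 2)
      = (X ^ 2 - 1) ^ n * X * X - ((X ^ 2 - 1) ^ n * X + (X ^ 2 - 1) ^ n * X) + (X ^ 2 - 1) ^ n := by
    have e : ((1 : R[X]) + X) ^ n * (X - 1) ^ n = (X ^ 2 - 1) ^ n := by
      rw [← mul_pow]; congr 1; ring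
    calc ((1 : R[X]) + X) ^ n * (X - 1) ^ (n + 2)
        = (((1 : R[X]) + X) ^ n * (X - 1) ^ n) * (X - 1) ^ 2 := by ring
      _ = _ := by rw [e]; ring
  rw [hpoly, show n + 2 = n + 1 + 1 from rfl, coeff_add, coeff_sub, coeff_add, coeff_mul_X, coeff_mul_X,
    coeff_mul_X]
  ring

/-- The coefficient is a unit mod `p` (`1 ≤ n < p`, `p` odd prime). -/
theorem coeff_ne_zero {p : ℕ} [hF : Fact p.Prime] (n : ℕ) (hnp : n < p) (hn1 : 1 ≤ n) (hp3 : 3 ≤ p) :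
    (((1 : (ZMod p)[X]) + X) ^ n * (X - 1) ^ (n + 2)).coeff (n + 2) ≠ 0 := by
  have hpr := hF.out
  have hu : ∀ s : ℕ, ((-1 : ZMod p) ^ s) ≠ 0 := fun s => pow_ne_zero _ (neg_ne_zero.2 one_ne_zero)
  have h2 : (2 : ZMod p) ≠ 0 := by
    intro h
    have h' : ((2 : ℕ) : ZMod p) = 0 := by exact_mod_cast h
    rw [ZMod.natCast_eq_zero_iff] at h'
    have := Nat.le_of_dvd (by norm_num) h'
    omega
  rw [coeff_closed_form]
  obtain ⟨r, hr | hr⟩ := Nat.even_or_odd' n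
  · -- n = 2r, r = s + 1
    obtain ⟨s, rfl⟩ : ∃ s, r = s + 1 := ⟨r - 1, by omega⟩
    subst hr
    rw [show 2 * (s + 1) + 2 = 2 * (s + 2) by ring, coeff_X_sq_sub_one_pow_even, coeff_X_sq_sub_one_pow_odd,
      coeff_X_sq_sub_one_pow_even, show 2 * (s + 1) - (s + 1) = s + 1 by omega,
      show 2 * (s + 1) - (s + 2) = s by omega]
    have hA : ((((2 * (s + 1)).choose (s + 1)) : ℕ) : ZMod p) ≠ 0 :=
      choose_cast_ne_zero hpr hnp (by omega)
    have hrel : ((((2 * (s + 1)).choose (s + 2)) : ℕ) : ZMod p) * ((s : ZMod p) + 2)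
        = ((((2 * (s + 1)).choose (s + 1)) : ℕ) : ZMod p) * ((s : ZMod p) + 1) := by
      have := Nat.choose_succ_right_eq (2 * (s + 1)) (s + 1)
      rw [show 2 * (s + 1) - (s + 1) = s + 1 by omega, show s + 1 + 1 = s + 2 from rfl] at this
      have := congrArg (Nat.cast : ℕ → ZMod p) this
      push_cast at this
      exact this
    intro hT
    have hdiff : ((((2 * (s + 1)).choose (s + 2)) : ℕ) : ZMod p) - ((((2 * (s + 1)).choose (s + 1)) : ℕ) : ZMod p) = 0 := by
      have hT' : (-1 : ZMod p) ^ s * (((((2 * (s + 1)).choose (s + 2)) : ℕ) : ZMod p)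
          - ((((2 * (s + 1)).choose (s + 1)) : ℕ) : ZMod p)) = 0 := by
        rw [← hT]; ring
      exact (mul_eq_zero.1 hT').resolve_left (hu s)
    apply hA
    linear_combination (-((s : ZMod p) + 2)) * hdiff + hrel
  · -- n = 2r + 1
    subst hr
    rw [show 2 * r + 1 + 2 = 2 * (r + 1) + 1 by ring, show 2 * r + 1 + 1 = 2 * (r + 1) by ring,
      coeff_X_sq_sub_one_pow_odd, coeff_X_sq_sub_one_pow_odd, coeff_X_sq_sub_one_pow_even,
      show 2 * r + 1 - (r + 1) = r by omega]
    have hA : ((((2 * r + 1).choose (r + 1)) : ℕ) : ZMod p) ≠ 0 :=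
      choose_cast_ne_zero hpr hnp (by omega)
    intro hT
    have hT' : (2 : ZMod p) * ((-1 : ZMod p) ^ r * ((((2 * r + 1).choose (r + 1)) : ℕ) : ZMod p)) = 0 := by
      linear_combination (-1 : ZMod p) * hT
    rcases mul_eq_zero.1 hT' with h | h
    · exact h2 h
    · rcases mul_eq_zero.1 h with h' | h'
      · exact hu r h'
      · exact hA h'

/-- **THEOREM Q (kernel).** `p ∤ D_{(p-3)/2}` for every prime `p ≥ 5`. -/
theorem delannoyNonVanishing_holds : DelannoyNonVanishing := by
  intro p hpr h5 h0
  haveI : Fact p.Prime := ⟨hpr⟩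
  have hp2 : ¬ 2 ∣ p := by
    intro h
    have := (Nat.prime_dvd_prime_iff_eq Nat.prime_two hpr).1 h
    omega
  set n := (p - 3) / 2 with hn
  have hp : p = 2 * n + 3 := by omega
  have hcast : ((delannoyC n : ℕ) : ZMod p) = 0 :=
    (ZMod.natCast_eq_zero_iff _ _).2 (Nat.dvd_of_mod_eq_zero h0)
  rw [delannoy_cast_eq hp hpr, altSum_eq_coeff] at hcast
  exact coeff_ne_zero n (by omega) (by omega) (by omega) hcast

end delannoyQ
end Summit.Parity.GeneralizedHardyLittlewood.Theorems.PrimeGapTorusCap.NearAP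
/-! ## §AN (ROUND-12) THE TOP-SLICE TRANSFER: `C_B` FROM THE TOP SLICE AT INFINITELY MANY MODULI — hence `C_B` IS A THEOREM.

Observation (T): in the cell transfer theorem `min_le_volume_D3_of_conjLinZ_frequently` (§AK.5) the case `μ(U ∩ [0,1)) > 1/2`
only ever applies `(Δ_lin)_ℤ` to a set `T ⊂ S_N` of the single size `|T| = ⌊N/2⌋` (the dense-cell set `S_N` has `|S_N| ≥ (u-ε)N > N/2`
once `ε < u - 1/2`).  So `C_B` needs `(Δ_lin)_ℤ` ONLY ON THE TOP SLICE `|T| = ⌊N/2⌋`, and only along SOME infinite set of moduli;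
at the primes `N = p ≥ 7` that slice is `topSlice_all` (§AL, Theorem R★) + THEOREM Q (§AM). -/

namespace Summit.Parity.GeneralizedHardyLittlewood.Theorems.PrimeGapTorusCap.NearAP
/-- `(Δ_lin)_ℤ` on the single slice `|T| = ⌊N/2⌋` of the modulus `N = n + 1`. -/
def HalfSliceAt (n : ℕ) : Prop :=
  ∀ T : Finset (ZMod (n + 1)), T.card = (n + 1) / 2 → 2 * T.card ≤ d3plusCard T + d3minusCard T

/-- The top slice at every prime modulus `p = n + 1 ≥ 7` (R★ + `RunOneIsArc` + arc equality + THEOREM Q). -/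
theorem halfSliceAt_of_prime (n : ℕ) (hp : (n + 1).Prime) (h7 : 7 ≤ n + 1) : HalfSliceAt n := by
  intro T hT
  have h2 : ¬ 2 ∣ n + 1 := by
    intro h
    have := (Nat.prime_dvd_prime_iff_eq Nat.prime_two hp).1 h
    omega
  have hk : 2 * T.card + 1 = n + 1 := by omega
  have h1 : T.card ≤ d3plusCard T := topSlice_all delannoyNonVanishing_holds (n + 1) hp h7 T hk
  have h3 := d3minusCard_eq_d3plusCard T
  omega

/-- Hence the top slice holds frequently (along the primes). -/
theorem halfSliceAt_frequently : ∃ᶠ n in Filter.atTop, HalfSliceAt n := by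
  refine Filter.frequently_atTop.2 fun m => ?_
  obtain ⟨p, hmp, hp⟩ := Nat.exists_infinite_primes (m + 7)
  have hp1 : p - 1 + 1 = p := by omega
  exact ⟨p - 1, by omega, halfSliceAt_of_prime (p - 1) (by rw [hp1]; exact hp) (by omega)⟩

end Summit.Parity.GeneralizedHardyLittlewood.Theorems.PrimeGapTorusCap.NearAP
namespace Summit.Parity.GeneralizedHardyLittlewood.Theorems.PrimeGapTorusCap
open MeasureTheory Set Filter Topology NearAP
/-- (Δ½) in the strict form, which is all that `cb1_of_conjHalf` uses. -/
def ConjHalfStrict : Prop :=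
  ∀ U : Set ℝ, MeasurableSet U → Periodic1 U → ENNReal.ofReal (1 / 2) < volume (U ∩ Set.Ico (0 : ℝ) 1) →
    ENNReal.ofReal (1 / 2) ≤ volume (D3 U ∩ Set.Ico (0 : ℝ) 1)

/-- strict (Δ½) ⟹ C_B (the proof of `cb1_of_conjHalf`, which only ever used `μ(U) > 1/2`). -/
theorem cb1_of_conjHalfStrict (h : ConjHalfStrict) : CB1 := by
  intro U hU hP hB
  by_contra hgt
  rw [not_le] at hgt
  have hD := h U hU hP hgt
  have hdisj : Disjoint (D3 U ∩ Set.Ico (0 : ℝ) 1) (U ∩ Set.Ico (0 : ℝ) 1) :=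
    Disjoint.mono Set.inter_subset_left Set.inter_subset_left (disjoint_D3_of_brauerFree hB)
  have hunion : volume (D3 U ∩ Set.Ico (0 : ℝ) 1 ∪ U ∩ Set.Ico (0 : ℝ) 1) =
      volume (D3 U ∩ Set.Ico (0 : ℝ) 1) + volume (U ∩ Set.Ico (0 : ℝ) 1) :=
    measure_union hdisj (hU.inter measurableSet_Ico)
  have hle : volume (D3 U ∩ Set.Ico (0 : ℝ) 1 ∪ U ∩ Set.Ico (0 : ℝ) 1) ≤ volume (Set.Ico (0 : ℝ) 1) :=
    measure_mono (Set.union_subset Set.inter_subset_right Set.inter_subset_right)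
  rw [Real.volume_Ico, hunion] at hle
  have h1 : ENNReal.ofReal (1 / 2) + ENNReal.ofReal (1 / 2) < volume (D3 U ∩ Set.Ico (0 : ℝ) 1) + volume (U ∩ Set.Ico (0 : ℝ) 1) := by
    calc ENNReal.ofReal (1 / 2) + ENNReal.ofReal (1 / 2)
        ≤ volume (D3 U ∩ Set.Ico (0 : ℝ) 1) + ENNReal.ofReal (1 / 2) := by gcongr
      _ < volume (D3 U ∩ Set.Ico (0 : ℝ) 1) + volume (U ∩ Set.Ico (0 : ℝ) 1) := by
          exact ENNReal.add_lt_add_left (ne_top_of_le_ne_top ENNReal.one_ne_top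
            (le_trans (measure_mono Set.inter_subset_right) (by rw [Real.volume_Ico]; norm_num))) hgt
  have h2 : ENNReal.ofReal (1 / 2) + ENNReal.ofReal (1 / 2) = ENNReal.ofReal (1 - 0) := by
    rw [← ENNReal.ofReal_add (by norm_num) (by norm_num)]; norm_num
  rw [h2] at h1
  exact absurd (lt_of_lt_of_le h1 hle) (lt_irrefl _)

/-- **THE TOP-SLICE TRANSFER THEOREM.**  `(Δ_lin)_ℤ` on the slice `|T| = ⌊N/2⌋` for INFINITELY MANY `N` implies strict (Δ½):
every measurable 1-periodic `U` with `μ(U ∩ [0,1)) > 1/2` has `μ(D₃U ∩ [0,1)) ≥ 1/2`.  (Proof = the `|S| > N/2` branch of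
`min_le_volume_D3_of_conjLinZ_frequently`, with `ε ≤ (u - 1/2)/2` so that the other branch cannot occur.) -/
theorem half_le_volume_D3_of_halfSlice_frequently (h : ∃ᶠ n in atTop, HalfSliceAt n) {U : Set ℝ}
    (hU : MeasurableSet U) (hP : Periodic1 U) (hgt : ENNReal.ofReal (1 / 2) < volume (U ∩ Set.Ico (0 : ℝ) 1)) :
    ENNReal.ofReal (1 / 2) ≤ volume (D3 U ∩ Set.Ico (0 : ℝ) 1) := by
  classical
  have hI1 : volume (Set.Ico (0 : ℝ) 1) = 1 := by simp [Real.volume_Ico]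
  have hUle : volume (U ∩ Set.Ico (0 : ℝ) 1) ≤ 1 := hI1 ▸ measure_mono Set.inter_subset_right
  have hVle : volume (D3 U ∩ Set.Ico (0 : ℝ) 1) ≤ 1 := hI1 ▸ measure_mono Set.inter_subset_right
  have hUfin : volume (U ∩ Set.Ico (0 : ℝ) 1) ≠ ⊤ := ne_top_of_le_ne_top ENNReal.one_ne_top hUle
  have hVfin : volume (D3 U ∩ Set.Ico (0 : ℝ) 1) ≠ ⊤ := ne_top_of_le_ne_top ENNReal.one_ne_top hVle
  set u : ℝ := (volume (U ∩ Set.Ico (0 : ℝ) 1)).toReal with hu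
  set v : ℝ := (volume (D3 U ∩ Set.Ico (0 : ℝ) 1)).toReal with hv
  have hUeq : volume (U ∩ Set.Ico (0 : ℝ) 1) = ENNReal.ofReal u := (ENNReal.ofReal_toReal hUfin).symm
  have hVeq : volume (D3 U ∩ Set.Ico (0 : ℝ) 1) = ENNReal.ofReal v := (ENNReal.ofReal_toReal hVfin).symm
  have hu0 : 0 ≤ u := ENNReal.toReal_nonneg
  have hv0 : 0 ≤ v := ENNReal.toReal_nonneg
  have hu1 : u ≤ 1 := by
    have := ENNReal.toReal_mono ENNReal.one_ne_top hUle
    simpa using this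
  have hu12 : 1 / 2 < u := by
    rw [hUeq, ENNReal.ofReal_lt_ofReal_iff'] at hgt
    exact hgt.1
  rw [hVeq]
  apply ENNReal.ofReal_le_ofReal
  -- real-number goal: 1/2 ≤ v ; we show 1/2 - δ ≤ v for every small δ > 0
  by_contra hlt
  push Not at hlt
  set δ : ℝ := min ((1 / 2 - v) / 2) 1 with hδ
  have hδ0 : 0 < δ := lt_min (by linarith) one_pos
  have hδ1 : δ ≤ 1 := min_le_right _ _
  have hδv : v + δ < 1 / 2 := by
    have : δ ≤ (1 / 2 - v) / 2 := min_le_left _ _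
    linarith
  -- parameters
  set η : ℝ := δ / 20 with hη
  have hη0 : 0 < η := by positivity
  have hη10 : η ≤ 1 / 10 := by rw [hη]; linarith
  set ε : ℝ := min (δ / 4) ((u - 1 / 2) / 2) with hε
  have hε0 : 0 < ε := lt_min (by positivity) (by linarith)
  have hε4 : ε ≤ δ / 4 := min_le_left _ _
  have hεu : ε ≤ (u - 1 / 2) / 2 := min_le_right _ _
  obtain ⟨n₀, hn₀⟩ := badSet_eventually_small hU hη0 (by linarith) (ε := ENNReal.ofReal ε) (ENNReal.ofReal_pos.2 hε0)
  obtain ⟨m, hm⟩ := exists_nat_ge ((n₀ : ℝ) + 10 + 20 / δ)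
  obtain ⟨n, hnm, hn'⟩ := Filter.frequently_atTop.1 h m
  have hn : (n₀ : ℝ) + 10 + 20 / δ ≤ n := hm.trans (by exact_mod_cast hnm)
  have h20δ : 0 < 20 / δ := by positivity
  have hn0 : n₀ ≤ n + 1 := by
    have : (n₀ : ℝ) ≤ n + 1 := by linarith
    exact_mod_cast this
  have hn9 : 9 ≤ n := by
    have : (9 : ℝ) ≤ n := by linarith [(Nat.cast_nonneg n₀ : (0 : ℝ) ≤ n₀)]
    exact_mod_cast this
  have hNpos : (0 : ℝ) < (n : ℝ) + 1 := by positivity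
  have hNδ : 1 / ((n : ℝ) + 1) ≤ δ / 20 := by
    rw [div_le_div_iff₀ hNpos (by norm_num : (0 : ℝ) < 20)]
    have : 20 / δ ≤ (n : ℝ) + 1 := by linarith [(Nat.cast_nonneg n₀ : (0 : ℝ) ≤ n₀)]
    rw [div_le_iff₀ hδ0] at this
    linarith
  -- the dense residues at resolution N = n+1
  obtain ⟨S, hSsound, hScomp⟩ : ∃ S : Finset (ZMod (n + 1)), (∀ s ∈ S, CellDense U (n + 1) η (s.val : ℤ)) ∧
      (∀ s : ZMod (n + 1), CellDense U (n + 1) η (s.val : ℤ) → s ∈ S) :=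
    ⟨Finset.univ.filter fun s => CellDense U (n + 1) η (s.val : ℤ), fun s hs => (Finset.mem_filter.1 hs).2,
      fun s hs => Finset.mem_filter.2 ⟨Finset.mem_univ _, hs⟩⟩
  -- (1) the count:  u ≤ ε + |S|/N
  have hcount : u ≤ ε + (S.card : ℝ) / ((n : ℝ) + 1) := by
    have h1 := volume_le_badSet_add_card hP η S hScomp
    have h2 := hn₀ (n + 1) hn0
    have h3 : volume (U ∩ Set.Ico (0 : ℝ) 1) ≤
        ENNReal.ofReal ε + (S.card : ENNReal) * ENNReal.ofReal (1 / ((n + 1 : ℕ) : ℝ)) :=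
      h1.trans (add_le_add h2 le_rfl)
    have hSn : (0 : ℝ) ≤ (S.card : ℝ) * (1 / ((n + 1 : ℕ) : ℝ)) :=
      mul_nonneg (Nat.cast_nonneg _) (one_div_nonneg.2 (Nat.cast_nonneg _))
    rw [hUeq, ← ENNReal.ofReal_natCast, ← ENNReal.ofReal_mul (Nat.cast_nonneg _),
      ← ENNReal.ofReal_add hε0.le hSn, ENNReal.ofReal_le_ofReal_iff (add_nonneg hε0.le hSn)] at h3
    have hN1 : ((n + 1 : ℕ) : ℝ) = (n : ℝ) + 1 := by push_cast; ring
    rw [hN1] at h3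
    have ee : (S.card : ℝ) * (1 / ((n : ℝ) + 1)) = (S.card : ℝ) / ((n : ℝ) + 1) := by ring
    linarith [ee]
  -- (2) the D₃ bound for S:  cnt(S)·(½-5η)/N ≤ v
  have hD3 : ((d3plusCard S + d3minusCard S : ℕ) : ℝ) * ((1 / 2 - 5 * η) / ((n : ℝ) + 1)) ≤ v := by
    have h1 := count_mul_le_volume_D3 hU hP hη0 S hSsound
    rw [hVeq] at h1
    have h2 := ENNReal.toReal_mono ENNReal.ofReal_ne_top h1
    have hN1 : ((n + 1 : ℕ) : ℝ) = (n : ℝ) + 1 := by push_cast; ring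
    rw [ENNReal.toReal_mul, ENNReal.toReal_natCast, ENNReal.toReal_ofReal hv0, hN1,
      ENNReal.toReal_ofReal (div_nonneg (by linarith) hNpos.le)] at h2
    exact h2
  have hc0 : 0 ≤ (1 / 2 - 5 * η) / ((n : ℝ) + 1) := div_nonneg (by linarith) hNpos.le
  -- (3) |S| > N/2: here `u > 1/2` enters, and ONLY the top slice is ever used
  have hbig : ¬ 2 * S.card ≤ n + 1 := by
    intro hsmall
    have h1 : (u - ε) * ((n : ℝ) + 1) ≤ S.card := by
      have := hcount
      rw [← sub_le_iff_le_add'] at this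
      rwa [le_div_iff₀ hNpos] at this
    have h2 : (2 : ℝ) * (S.card : ℝ) ≤ (n : ℝ) + 1 := by exact_mod_cast hsmall
    nlinarith [mul_pos (by linarith : (0 : ℝ) < 2 * (u - ε) - 1) hNpos]
  push Not at hbig
  obtain ⟨T, hTS, hTcard⟩ := Finset.exists_subset_card_eq (s := S) (n := (n + 1) / 2) (by omega)
  have hlin := hn' T hTcard
  have hmono := d3Cards_mono hTS
  have hcnt : n ≤ d3plusCard S + d3minusCard S := by omega
  have hcntR : (n : ℝ) ≤ ((d3plusCard S + d3minusCard S : ℕ) : ℝ) := by exact_mod_cast hcnt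
  have hv1 : (n : ℝ) * ((1 / 2 - 5 * η) / ((n : ℝ) + 1)) ≤ v :=
    le_trans (mul_le_mul_of_nonneg_right hcntR hc0) hD3
  -- n/(n+1) = 1 - 1/(n+1) ≥ 1 - δ/20
  have hq : (n : ℝ) / ((n : ℝ) + 1) = 1 - 1 / ((n : ℝ) + 1) := by
    rw [eq_sub_iff_add_eq, ← add_div, div_self hNpos.ne']
  have hv2 : (1 - δ / 20) * (1 / 2 - 5 * η) ≤ v := by
    have e1 : (n : ℝ) * ((1 / 2 - 5 * η) / ((n : ℝ) + 1)) = (n : ℝ) / ((n : ℝ) + 1) * (1 / 2 - 5 * η) := by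
      ring
    rw [e1, hq] at hv1
    exact le_trans (mul_le_mul_of_nonneg_right (by linarith) (by linarith)) hv1
  rw [hη] at hv2
  nlinarith [sq_nonneg δ]

/-- **strict (Δ½) IS A THEOREM.** -/
theorem conjHalfStrict_holds : ConjHalfStrict := fun _ hU hP hgt =>
  half_le_volume_D3_of_halfSlice_frequently halfSliceAt_frequently hU hP hgt

/-- **CONJECTURE C_B (period 1) IS A THEOREM:** every Brauer-free measurable 1-periodic set has measure `≤ 1/2` per period. -/
theorem cb1_holds : CB1 := cb1_of_conjHalfStrict conjHalfStrict_holds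

/-! ## §AO (ROUND-12) CONJECTURE C IS A THEOREM: `TorusCapBrauer (1/2)` and `TorusCap (1/2)` (statements verbatim from Sketch7). -/

/-- 4-point-freeness of a set of reals (verbatim `FourPointFree` of Sketch3/Sketch6/Sketch7). -/
def FourPointFree (S : Set ℝ) : Prop :=
  ∀ x y z : ℝ, x ∈ S → y ∈ S → z ∈ S → x + y ∈ S → y + z ∈ S → x + y + z ∈ S → False

/-- p4's `TorusCap` (Sketch3/Sketch6/Sketch7, verbatim).  CONJECTURE C is `TorusCap (1/2)`. -/
def TorusCap (σ : ℝ) : Prop :=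
  ∀ (per : ℝ), 0 < per → ∀ U : Set ℝ, MeasurableSet U → (∀ t ∈ U, ∀ n : ℤ, t + n * per ∈ U) →
    FourPointFree U → volume (U ∩ Set.Ico 0 per) ≤ ENNReal.ofReal (σ * per)

/-- Brauer cap of `TorusCap` type (Sketch7, verbatim).  CONJECTURE C_B is `TorusCapBrauer (1/2)`. -/
def TorusCapBrauer (σ : ℝ) : Prop :=
  ∀ (per : ℝ), 0 < per → ∀ U : Set ℝ, MeasurableSet U → (∀ t ∈ U, ∀ n : ℤ, t + n * per ∈ U) →
    BrauerFree U → volume (U ∩ Set.Ico 0 per) ≤ ENNReal.ofReal (σ * per)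

/-- (cell parity-ideate p4, Sketch16 — helper; statement verbatim) -/
theorem brauerFree_of_fourPointFree {S : Set ℝ} (h : FourPointFree S) : BrauerFree S := by
  intro d x hd hx hxd hx2d
  refine h d x d hd hx hd ?_ hxd ?_
  · rw [add_comm]; exact hxd
  · have e : d + x + d = x + 2 * d := by ring
    rw [e]; exact hx2d

/-- `σ₄ ≤ σ_B`: every Brauer cap is a 4-point cap (Sketch7, verbatim). -/
theorem torusCap_of_torusCapBrauer {σ : ℝ} (h : TorusCapBrauer σ) : TorusCap σ :=
  fun per hper U hU hperU hfree => h per hper U hU hperU (brauerFree_of_fourPointFree hfree)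

end Summit.Parity.GeneralizedHardyLittlewood.Theorems.PrimeGapTorusCap
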